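import Summits.MatrixMultiplication.MatrixMultiplication.Theorems.GradedDesignFamily.Negative.ExponentTwoEndpoint

/-!
# `GradedDesignFamily` (crux `stmt-MatrixMultiplication-7610`, route `LevelGradedCohnUmans`):
# the graded packing law (negative-side support, part 2)

Support file of the crux disprover (cdisprove seat, cycle 1); everything `sorry`-free; continues
`ExponentTwoEndpoint`.  Notation as there; `N = #(Irr(G) ∩ J)`, `k(G)` = number of conjugacy
classes.  Proved here, for every WITNESS AT `ε > 0` (bi-invariant `J`, `J`-separated triple,
`budget_(2+ε) < V^((2+ε)/3)`):

* `two_mul_sq_le_cube`, `two_mul_sq_volume_le`, `two_mul_volume_sq_le_finrank_cube` — the SHARPER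
  WALL `2V² ≤ D³` once `D ≥ 2` (graded Neumann count + `2(pm+p²)² ≤ (p²+m)³`);
  `two_le_finrank_of_witness` — a witness has `D ≥ 2`;
* `ncard_irrChars_inter_le_card_conjClasses/_le_finrank` — `N ≤ k(G)`, `N ≤ D`;
  `gradedBudget_two_rpow_le` — power mean `budget₂^((2+ε)/2) ≤ N^(ε/2) · budget_(2+ε)`;
* `ncard_irrChars_inter_law` — THE PACKING LAW `N^ε > 2^((2+ε)/3)` (chain
  `D^((2+ε)/2) ≤ budget₂^((2+ε)/2) ≤ N^(ε/2) budget_(2+ε) < N^(ε/2) V^((2+ε)/3)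
  ≤ N^(ε/2) (D³/2)^((2+ε)/6)`); corollaries `two_le_ncard_irrChars_inter` (NO SINGLE-BLOCK
  DESIGN), `conjClasses_law`, `finrank_law`, `card_law` (`k(G)^ε, D^ε, |G|^ε > 2^((2+ε)/3)`;
  a witness at `ε = 1/100` needs `|G| > 2^67`);
* `no_witness_of_small_eps`, `no_fixed_host` — NO FIXED HOST: a finite group witnesses no
  `ε ≤ (2/3) log 2 / log k(G)`; every witness family lets `|G| → ∞` (`log k(G) ≳ 1/ε`).
The sharp constants (`N ≳ (27/4)^((2+ε)/(3ε))`) are in part 3, `GradedNeumannReal`.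
-/

noncomputable section

set_option linter.dupNamespace false

open scoped BigOperators
open Module Literature.RepresentationTheory.FiniteGroups Literature.Computability.AlgebraicComplexity

namespace Summit.MatrixMultiplication.MatrixMultiplication.Theorems.GradedDesignFamily.Negative

variable {G : Type} [Group G]

/-! ## The sharper wall `2V² ≤ D³` -/

/-- Arithmetic core: `2 (p m + p²)² ≤ (p² + m)³` unless `p ≤ 1 ∧ m = 0`. [folklore] -/
theorem two_mul_sq_le_cube (p m : ℕ) (h : 2 ≤ p ∨ 1 ≤ m) :
    2 * (p * m + p ^ 2) ^ 2 ≤ (p ^ 2 + m) ^ 3 := by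
  rcases Nat.lt_or_ge p 2 with hp | hp
  · interval_cases p
    · ring_nf
      nlinarith [Nat.zero_le (m ^ 3)]
    · have hm : 1 ≤ m := by omega
      obtain ⟨k, rfl⟩ : ∃ k, m = k + 1 := ⟨m - 1, by omega⟩
      ring_nf
      nlinarith [Nat.zero_le k, Nat.zero_le (k ^ 2), Nat.zero_le (k ^ 3)]
  · have h1 : 2 * p ^ 4 ≤ p ^ 6 := by
      have : 2 ≤ p ^ 2 := by nlinarith
      calc 2 * p ^ 4 ≤ p ^ 2 * p ^ 4 := Nat.mul_le_mul_right _ this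
        _ = p ^ 6 := by ring
    have h2 : 4 * p ^ 3 * m ≤ 3 * p ^ 4 * m := by
      have h4 : 4 * p ^ 3 ≤ 3 * p ^ 4 := by
        have : 4 ≤ 3 * p := by omega
        calc 4 * p ^ 3 ≤ 3 * p * p ^ 3 := Nat.mul_le_mul_right _ this
          _ = 3 * p ^ 4 := by ring
      exact Nat.mul_le_mul_right m h4
    nlinarith [h1, h2, Nat.zero_le (p ^ 2 * m ^ 2), Nat.zero_le (m ^ 3)]

/-- Counting core: `1 ≤ p ≤ q`, the slab count `pq + qb ≤ D` of the larger side and `D ≥ 2`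
give `2 (p (b+1) q)² ≤ D³` (`V ≤ pD + p² - p³ = pm + p²` with `D = p² + m`). [folklore] -/
theorem two_mul_sq_volume_le (p q b D : ℕ) (hp : 1 ≤ p) (hpq : p ≤ q)
    (hN : p * q + q * b ≤ D) (hD : 2 ≤ D) : 2 * (p * (b + 1) * q) ^ 2 ≤ D ^ 3 := by
  have hp2 : p ^ 2 ≤ D := by nlinarith
  obtain ⟨m, rfl⟩ : ∃ m, D = p ^ 2 + m := ⟨D - p ^ 2, by omega⟩
  have key : p * (p * q + q * b) ≤ p * (p ^ 2 + m) := Nat.mul_le_mul_left _ hN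
  have hV : p * (b + 1) * q ≤ p * m + p ^ 2 := by
    zify at key hp hpq ⊢
    have hint : (0 : ℤ) ≤ (p : ℤ) * ((p : ℤ) - 1) * ((q : ℤ) - (p : ℤ)) :=
      mul_nonneg (mul_nonneg (by linarith) (by linarith)) (by linarith)
    nlinarith [key, hint]
  have hpm : 2 ≤ p ∨ 1 ≤ m := by
    rcases Nat.lt_or_ge p 2 with h | h
    · right
      have : p = 1 := by omega
      subst this
      omega
    · exact Or.inl h
  calc 2 * (p * (b + 1) * q) ^ 2 ≤ 2 * (p * m + p ^ 2) ^ 2 :=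
        Nat.mul_le_mul_left 2 (Nat.pow_le_pow_left hV 2)
    _ ≤ (p ^ 2 + m) ^ 3 := two_mul_sq_le_cube p m hpm

section Law

variable [Fintype G]

/-- **Sharper wall**: bi-invariant `J` with `dim J ≥ 2`, `J`-separated triple ⇒ `2V² ≤ (dim J)³`
(graded Neumann count + the counting core). [folklore] -/
theorem two_mul_volume_sq_le_finrank_cube (J : Submodule ℂ (G → ℂ)) (hJ : (∀ f ∈ J, ∀ a b : G, (fun g : G => f (a * g * b)) ∈ J))
    (X Y Z : Finset G) (h : (∀ x₀ ∈ X, ∀ z₀ ∈ Z, ∃ f ∈ J, ∀ x ∈ X, ∀ y ∈ Y, ∀ y' ∈ Y, ∀ z ∈ Z,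
      (x = x₀ ∧ y = y' ∧ z = z₀ → f (x⁻¹ * y * y'⁻¹ * z) = 1) ∧
      (¬ (x = x₀ ∧ y = y' ∧ z = z₀) → f (x⁻¹ * y * y'⁻¹ * z) = 0))) (hD : 2 ≤ finrank ℂ J) :
    2 * (X.card * Y.card * Z.card) ^ 2 ≤ (finrank ℂ J) ^ 3 := by
  classical
  rcases X.eq_empty_or_nonempty with rfl | ⟨x₁, hx₁⟩
  · simp
  rcases Y.eq_empty_or_nonempty with rfl | ⟨y₁, hy₁⟩
  · simp
  rcases Z.eq_empty_or_nonempty with rfl | ⟨z₁, hz₁⟩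
  · simp
  have hr : ∀ f ∈ J, ∀ t : G, (fun g => f (g * t)) ∈ J := fun f hf t => by
    simpa only [one_mul] using hJ f hf 1 t
  have hl : ∀ f ∈ J, ∀ t : G, (fun g => f (t * g)) ∈ J := fun f hf t => by
    simpa only [mul_one] using hJ f hf t 1
  have N1 := LevelTwoBeatsCubes.Negative.packing_X J hr X Y Z h hy₁ hz₁
  have N2 := LevelTwoBeatsCubes.Negative.packing_Z J hl X Y Z h hx₁ hy₁
  have ha : 1 ≤ X.card := Finset.card_pos.mpr ⟨x₁, hx₁⟩
  have hc : 1 ≤ Z.card := Finset.card_pos.mpr ⟨z₁, hz₁⟩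
  obtain ⟨b, hbY⟩ : ∃ b, Y.card = b + 1 := ⟨Y.card - 1, by
    have := Finset.card_pos.mpr ⟨y₁, hy₁⟩; omega⟩
  rw [hbY] at N1 N2 ⊢
  simp only [Nat.add_sub_cancel] at N1 N2
  set a := X.card
  set c := Z.card
  set D := finrank ℂ J
  rcases le_total c a with hca | hac
  · have hN : c * a + a * b ≤ D := by simpa only [mul_comm c a] using N1
    have := two_mul_sq_volume_le c a b D hc hca hN hD
    calc 2 * (a * (b + 1) * c) ^ 2 = 2 * (c * (b + 1) * a) ^ 2 := by ring
      _ ≤ D ^ 3 := this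
  · have hN : a * c + c * b ≤ D := by simpa only [mul_comm c b] using N2
    exact two_mul_sq_volume_le a c b D ha hac hN hD

/-- `#(Irr ∩ J) ≤ #` conjugacy classes. [folklore] -/
theorem ncard_irrChars_inter_le_card_conjClasses (J : Submodule ℂ (G → ℂ)) :
    (irrChars G ∩ (J : Set (G → ℂ))).ncard ≤ Nat.card (ConjClasses G) := by
  rw [← ncard_irrChars_eq_card_conjClasses]
  exact Set.ncard_le_ncard Set.inter_subset_left (irrChars_finite_holds G)

/-- `#(Irr ∩ J) ≤ dim J` (linear independence of irreducible characters). [folklore] -/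
theorem ncard_irrChars_inter_le_finrank (J : Submodule ℂ (G → ℂ)) :
    (irrChars G ∩ (J : Set (G → ℂ))).ncard ≤ finrank ℂ J := by
  classical
  have hfin : (irrChars G ∩ (J : Set (G → ℂ))).Finite :=
    (irrChars_finite_holds G).subset Set.inter_subset_left
  rw [Set.ncard_eq_toFinset_card _ hfin]
  have hmem : ∀ χ ∈ hfin.toFinset, χ ∈ irrChars G ∩ (J : Set (G → ℂ)) :=
    fun χ hχ => hfin.mem_toFinset.1 hχ
  let v : hfin.toFinset → J := fun χ => ⟨χ.1, (hmem χ.1 χ.2).2⟩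
  have h1 : LinearIndependent ℂ (J.subtype ∘ v) := by
    let e : hfin.toFinset → irrChars G := fun χ => ⟨χ.1, (hmem χ.1 χ.2).1⟩
    have he : Function.Injective e := fun a b h =>
      Subtype.ext (by simpa [e] using congrArg Subtype.val h)
    exact (linearIndependent_irrChars (G := G)).comp e he
  have hli : LinearIndependent ℂ v := LinearIndependent.of_comp J.subtype h1
  simpa using hli.fintype_card_le_finrank

/-- **Power mean**: `budget₂^((2+ε)/2) ≤ N^(ε/2) · budget_(2+ε)`, `N = #(Irr ∩ J)` (Jensen).
[folklore] -/
theorem gradedBudget_two_rpow_le (J : Submodule ℂ (G → ℂ)) {ε : ℝ} (hε : 0 ≤ ε) :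
    (∑ᶠ χ ∈ irrChars G ∩ (J : Set (G → ℂ)), (χ 1).re ^ ((2) : ℝ)) ^ ((2 + ε) / 2)
      ≤ ((irrChars G ∩ (J : Set (G → ℂ))).ncard : ℝ) ^ (ε / 2) * (∑ᶠ χ ∈ irrChars G ∩ (J : Set (G → ℂ)), (χ 1).re ^ ((2 + ε) : ℝ)) := by
  have hfin : (irrChars G ∩ (J : Set (G → ℂ))).Finite :=
    (irrChars_finite_holds G).subset Set.inter_subset_left
  rw [gradedBudget_eq_sum, gradedBudget_eq_sum, Set.ncard_eq_toFinset_card _ hfin]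
  set S := hfin.toFinset
  have hq : 1 ≤ (2 + ε) / 2 := by linarith
  have hnn : ∀ χ ∈ S, 0 ≤ (χ 1).re ^ (2 : ℝ) := fun χ hχ =>
    Real.rpow_nonneg (zero_le_one.trans
      (one_le_re_apply_one ((Set.Finite.mem_toFinset _).1 hχ).1)) _
  have key := Real.rpow_sum_le_const_mul_sum_rpow_of_nonneg S hq hnn
  have hexp : (2 + ε) / 2 - 1 = ε / 2 := by ring
  rw [hexp] at key
  refine key.trans (le_of_eq ?_)
  congr 1
  refine Finset.sum_congr rfl fun χ hχ => ?_
  have h0 : 0 ≤ (χ 1).re :=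
    zero_le_one.trans (one_le_re_apply_one ((Set.Finite.mem_toFinset _).1 hχ).1)
  rw [← Real.rpow_mul h0]
  congr 1
  ring

/-- A witness has `dim J ≥ 2` (if `dim J ≤ 1` then `V ≤ 1 ≤ budget`). [folklore] -/
theorem two_le_finrank_of_witness {ε : ℝ} (hε : 0 < ε) (J : Submodule ℂ (G → ℂ))
    (hJ : (∀ f ∈ J, ∀ a b : G, (fun g : G => f (a * g * b)) ∈ J)) (X Y Z : Finset G) (hsep : (∀ x₀ ∈ X, ∀ z₀ ∈ Z, ∃ f ∈ J, ∀ x ∈ X, ∀ y ∈ Y, ∀ y' ∈ Y, ∀ z ∈ Z,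
      (x = x₀ ∧ y = y' ∧ z = z₀ → f (x⁻¹ * y * y'⁻¹ * z) = 1) ∧
      (¬ (x = x₀ ∧ y = y' ∧ z = z₀) → f (x⁻¹ * y * y'⁻¹ * z) = 0)))
    (hlt : (∑ᶠ χ ∈ irrChars G ∩ (J : Set (G → ℂ)), (χ 1).re ^ ((2 + ε) : ℝ)) < ((X.card * Y.card * Z.card : ℕ) : ℝ) ^ ((2 + ε) / 3)) :
    2 ≤ finrank ℂ J := by
  have hV := volume_pos_of_witness hε J X Y Z hlt
  have hsq := volume_sq_le_finrank_cube J hJ X Y Z hsep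
  by_contra h2
  push Not at h2
  have hb1 : (finrank ℂ J : ℝ) ≤ (∑ᶠ χ ∈ irrChars G ∩ (J : Set (G → ℂ)), (χ 1).re ^ ((2 + ε) : ℝ)) :=
    (finrank_le_gradedBudget_two J hJ).trans (gradedBudget_mono J (by linarith))
  interval_cases hD : finrank ℂ J
  · have : 0 < (X.card * Y.card * Z.card) ^ 2 := by positivity
    omega
  · have hV1 : X.card * Y.card * Z.card = 1 := by nlinarith
    rw [hV1, Nat.cast_one, Real.one_rpow] at hlt
    simp only [Nat.cast_one] at hb1
    linarith

/-- **THE PACKING LAW.**  Every witness at `ε > 0` — in any finite group — has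
`#(Irr(G) ∩ J)^ε > 2^((2+ε)/3)`: the tests must see exponentially many (in `1/ε`) irreducibles.
Chain: `D^((2+ε)/2) ≤ budget₂^((2+ε)/2) ≤ N^(ε/2) budget_(2+ε) < N^(ε/2) V^((2+ε)/3)
≤ N^(ε/2) (D³/2)^((2+ε)/6)`. [folklore] -/
theorem ncard_irrChars_inter_law {ε : ℝ} (hε : 0 < ε) (J : Submodule ℂ (G → ℂ))
    (hJ : (∀ f ∈ J, ∀ a b : G, (fun g : G => f (a * g * b)) ∈ J)) (X Y Z : Finset G) (hsep : (∀ x₀ ∈ X, ∀ z₀ ∈ Z, ∃ f ∈ J, ∀ x ∈ X, ∀ y ∈ Y, ∀ y' ∈ Y, ∀ z ∈ Z,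
      (x = x₀ ∧ y = y' ∧ z = z₀ → f (x⁻¹ * y * y'⁻¹ * z) = 1) ∧
      (¬ (x = x₀ ∧ y = y' ∧ z = z₀) → f (x⁻¹ * y * y'⁻¹ * z) = 0)))
    (hlt : (∑ᶠ χ ∈ irrChars G ∩ (J : Set (G → ℂ)), (χ 1).re ^ ((2 + ε) : ℝ)) < ((X.card * Y.card * Z.card : ℕ) : ℝ) ^ ((2 + ε) / 3)) :
    (2 : ℝ) ^ ((2 + ε) / 3) < ((irrChars G ∩ (J : Set (G → ℂ))).ncard : ℝ) ^ ε := by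
  have hD2 := two_le_finrank_of_witness hε J hJ X Y Z hsep hlt
  set D := finrank ℂ J with hDdef
  set N := (irrChars G ∩ (J : Set (G → ℂ))).ncard with hNdef
  have hDpos : (0 : ℝ) < D := by exact_mod_cast (show 0 < D by omega)
  have hDa : (0 : ℝ) < (D : ℝ) ^ ((2 + ε) / 2) := Real.rpow_pos_of_pos hDpos _
  have h1 : (D : ℝ) ^ ((2 + ε) / 2) ≤ (N : ℝ) ^ (ε / 2) * (∑ᶠ χ ∈ irrChars G ∩ (J : Set (G → ℂ)), (χ 1).re ^ ((2 + ε) : ℝ)) :=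
    (Real.rpow_le_rpow hDpos.le (finrank_le_gradedBudget_two J hJ) (by positivity)).trans
      (gradedBudget_two_rpow_le J hε.le)
  have hV2 := two_mul_volume_sq_le_finrank_cube J hJ X Y Z hsep hD2
  have h0V : (0 : ℝ) ≤ ((X.card * Y.card * Z.card : ℕ) : ℝ) := Nat.cast_nonneg _
  have hsq : ((X.card * Y.card * Z.card : ℕ) : ℝ) ^ (2 : ℕ) ≤ (D : ℝ) ^ (3 : ℕ) / 2 := by
    have h' : (2 : ℝ) * (((X.card * Y.card * Z.card : ℕ) : ℝ)) ^ (2 : ℕ) ≤ (D : ℝ) ^ (3 : ℕ) := by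
      exact_mod_cast hV2
    linarith
  have hVR : ((X.card * Y.card * Z.card : ℕ) : ℝ) ≤ ((D : ℝ) ^ (3 : ℕ) / 2) ^ ((1 : ℝ) / 2) := by
    calc ((X.card * Y.card * Z.card : ℕ) : ℝ) = (((X.card * Y.card * Z.card : ℕ) : ℝ) ^ (2 : ℕ)) ^ ((1 : ℝ) / 2) := by
          rw [← Real.sqrt_eq_rpow, Real.sqrt_sq h0V]
      _ ≤ ((D : ℝ) ^ (3 : ℕ) / 2) ^ ((1 : ℝ) / 2) :=
          Real.rpow_le_rpow (by positivity) hsq (by norm_num)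
  have h2 : ((X.card * Y.card * Z.card : ℕ) : ℝ) ^ ((2 + ε) / 3)
      ≤ (D : ℝ) ^ ((2 + ε) / 2) / (2 : ℝ) ^ ((2 + ε) / 6) := by
    calc ((X.card * Y.card * Z.card : ℕ) : ℝ) ^ ((2 + ε) / 3)
        ≤ (((D : ℝ) ^ (3 : ℕ) / 2) ^ ((1 : ℝ) / 2)) ^ ((2 + ε) / 3) :=
          Real.rpow_le_rpow h0V hVR (by positivity)
      _ = ((D : ℝ) ^ (3 : ℕ) / 2) ^ ((2 + ε) / 6) := by
          rw [← Real.rpow_mul (by positivity)]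
          ring_nf
      _ = ((D : ℝ) ^ (3 : ℕ)) ^ ((2 + ε) / 6) / (2 : ℝ) ^ ((2 + ε) / 6) := by
          rw [Real.div_rpow (by positivity) (by norm_num)]
      _ = (D : ℝ) ^ ((2 + ε) / 2) / (2 : ℝ) ^ ((2 + ε) / 6) := by
          congr 1
          rw [show ((D : ℝ) ^ (3 : ℕ)) = (D : ℝ) ^ (3 : ℝ) by norm_cast,
            ← Real.rpow_mul hDpos.le]
          ring_nf
  have hNpos : (0 : ℝ) < (N : ℝ) ^ (ε / 2) := by
    by_contra hle
    push Not at hle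
    have h0 : (N : ℝ) ^ (ε / 2) = 0 := le_antisymm hle (Real.rpow_nonneg (Nat.cast_nonneg _) _)
    rw [h0, zero_mul] at h1
    linarith
  have h3 : (D : ℝ) ^ ((2 + ε) / 2)
      < (N : ℝ) ^ (ε / 2) * ((D : ℝ) ^ ((2 + ε) / 2) / (2 : ℝ) ^ ((2 + ε) / 6)) :=
    h1.trans_lt ((mul_lt_mul_of_pos_left hlt hNpos).trans_le
      (mul_le_mul_of_nonneg_left h2 hNpos.le))
  have h2pos : (0 : ℝ) < (2 : ℝ) ^ ((2 + ε) / 6) := Real.rpow_pos_of_pos two_pos _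
  have h4 : (2 : ℝ) ^ ((2 + ε) / 6) < (N : ℝ) ^ (ε / 2) := by
    rw [mul_div_assoc', lt_div_iff₀ h2pos] at h3
    nlinarith
  have h0N : (0 : ℝ) ≤ (N : ℝ) := Nat.cast_nonneg _
  calc (2 : ℝ) ^ ((2 + ε) / 3) = ((2 : ℝ) ^ ((2 + ε) / 6)) ^ (2 : ℝ) := by
        rw [← Real.rpow_mul (by norm_num)]
        ring_nf
    _ < ((N : ℝ) ^ (ε / 2)) ^ (2 : ℝ) := Real.rpow_lt_rpow h2pos.le h4 two_pos
    _ = (N : ℝ) ^ ε := by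
        rw [← Real.rpow_mul h0N]
        ring_nf

/-- **No single-block design**: every witness sees at least TWO irreducible characters (a single
isotypic block `M_d`, `dim = d²`, budget `d^(2+ε)`, never carries volume `> d³`). [folklore] -/
theorem two_le_ncard_irrChars_inter {ε : ℝ} (hε : 0 < ε) (J : Submodule ℂ (G → ℂ))
    (hJ : (∀ f ∈ J, ∀ a b : G, (fun g : G => f (a * g * b)) ∈ J)) (X Y Z : Finset G) (hsep : (∀ x₀ ∈ X, ∀ z₀ ∈ Z, ∃ f ∈ J, ∀ x ∈ X, ∀ y ∈ Y, ∀ y' ∈ Y, ∀ z ∈ Z,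
      (x = x₀ ∧ y = y' ∧ z = z₀ → f (x⁻¹ * y * y'⁻¹ * z) = 1) ∧
      (¬ (x = x₀ ∧ y = y' ∧ z = z₀) → f (x⁻¹ * y * y'⁻¹ * z) = 0)))
    (hlt : (∑ᶠ χ ∈ irrChars G ∩ (J : Set (G → ℂ)), (χ 1).re ^ ((2 + ε) : ℝ)) < ((X.card * Y.card * Z.card : ℕ) : ℝ) ^ ((2 + ε) / 3)) :
    2 ≤ (irrChars G ∩ (J : Set (G → ℂ))).ncard := by
  have h := ncard_irrChars_inter_law hε J hJ X Y Z hsep hlt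
  have h1 : (1 : ℝ) < (2 : ℝ) ^ ((2 + ε) / 3) := Real.one_lt_rpow one_lt_two (by positivity)
  by_contra hlt2
  push Not at hlt2
  have h2 : ((irrChars G ∩ (J : Set (G → ℂ))).ncard : ℝ) ^ ε ≤ 1 := by
    interval_cases hN : (irrChars G ∩ (J : Set (G → ℂ))).ncard
    · rw [Nat.cast_zero, Real.zero_rpow hε.ne']
      norm_num
    · rw [Nat.cast_one, Real.one_rpow]
  linarith

/-- **Host form**: `k(G)^ε > 2^((2+ε)/3)`, `k(G)` = number of conjugacy classes. [folklore] -/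
theorem conjClasses_law {ε : ℝ} (hε : 0 < ε) (J : Submodule ℂ (G → ℂ))
    (hJ : (∀ f ∈ J, ∀ a b : G, (fun g : G => f (a * g * b)) ∈ J)) (X Y Z : Finset G) (hsep : (∀ x₀ ∈ X, ∀ z₀ ∈ Z, ∃ f ∈ J, ∀ x ∈ X, ∀ y ∈ Y, ∀ y' ∈ Y, ∀ z ∈ Z,
      (x = x₀ ∧ y = y' ∧ z = z₀ → f (x⁻¹ * y * y'⁻¹ * z) = 1) ∧
      (¬ (x = x₀ ∧ y = y' ∧ z = z₀) → f (x⁻¹ * y * y'⁻¹ * z) = 0)))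
    (hlt : (∑ᶠ χ ∈ irrChars G ∩ (J : Set (G → ℂ)), (χ 1).re ^ ((2 + ε) : ℝ)) < ((X.card * Y.card * Z.card : ℕ) : ℝ) ^ ((2 + ε) / 3)) :
    (2 : ℝ) ^ ((2 + ε) / 3) < (Nat.card (ConjClasses G) : ℝ) ^ ε :=
  (ncard_irrChars_inter_law hε J hJ X Y Z hsep hlt).trans_le (Real.rpow_le_rpow
    (Nat.cast_nonneg _) (Nat.cast_le.2 (ncard_irrChars_inter_le_card_conjClasses J)) hε.le)

/-- **Dimension form**: `(dim J)^ε > 2^((2+ε)/3)`. [folklore] -/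
theorem finrank_law {ε : ℝ} (hε : 0 < ε) (J : Submodule ℂ (G → ℂ))
    (hJ : (∀ f ∈ J, ∀ a b : G, (fun g : G => f (a * g * b)) ∈ J)) (X Y Z : Finset G) (hsep : (∀ x₀ ∈ X, ∀ z₀ ∈ Z, ∃ f ∈ J, ∀ x ∈ X, ∀ y ∈ Y, ∀ y' ∈ Y, ∀ z ∈ Z,
      (x = x₀ ∧ y = y' ∧ z = z₀ → f (x⁻¹ * y * y'⁻¹ * z) = 1) ∧
      (¬ (x = x₀ ∧ y = y' ∧ z = z₀) → f (x⁻¹ * y * y'⁻¹ * z) = 0)))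
    (hlt : (∑ᶠ χ ∈ irrChars G ∩ (J : Set (G → ℂ)), (χ 1).re ^ ((2 + ε) : ℝ)) < ((X.card * Y.card * Z.card : ℕ) : ℝ) ^ ((2 + ε) / 3)) :
    (2 : ℝ) ^ ((2 + ε) / 3) < (finrank ℂ J : ℝ) ^ ε :=
  (ncard_irrChars_inter_law hε J hJ X Y Z hsep hlt).trans_le (Real.rpow_le_rpow
    (Nat.cast_nonneg _) (Nat.cast_le.2 (ncard_irrChars_inter_le_finrank J)) hε.le)

/-- **Order form**: `|G|^ε > 2^((2+ε)/3)` — e.g. a witness at `ε = 1/100` needs `|G| > 2^67`.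
[folklore] -/
theorem card_law {ε : ℝ} (hε : 0 < ε) (J : Submodule ℂ (G → ℂ))
    (hJ : (∀ f ∈ J, ∀ a b : G, (fun g : G => f (a * g * b)) ∈ J)) (X Y Z : Finset G) (hsep : (∀ x₀ ∈ X, ∀ z₀ ∈ Z, ∃ f ∈ J, ∀ x ∈ X, ∀ y ∈ Y, ∀ y' ∈ Y, ∀ z ∈ Z,
      (x = x₀ ∧ y = y' ∧ z = z₀ → f (x⁻¹ * y * y'⁻¹ * z) = 1) ∧
      (¬ (x = x₀ ∧ y = y' ∧ z = z₀) → f (x⁻¹ * y * y'⁻¹ * z) = 0)))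
    (hlt : (∑ᶠ χ ∈ irrChars G ∩ (J : Set (G → ℂ)), (χ 1).re ^ ((2 + ε) : ℝ)) < ((X.card * Y.card * Z.card : ℕ) : ℝ) ^ ((2 + ε) / 3)) :
    (2 : ℝ) ^ ((2 + ε) / 3) < (Nat.card G : ℝ) ^ ε :=
  (conjClasses_law hε J hJ X Y Z hsep hlt).trans_le (Real.rpow_le_rpow (Nat.cast_nonneg _)
    (Nat.cast_le.2 (Nat.card_le_card_of_surjective _ ConjClasses.mk_surjective)) hε.le)

/-- **No fixed host, quantitative**: a finite group `G` witnesses NO exponent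
`ε ≤ (2/3) log 2 / log k(G)`. [folklore] -/
theorem no_witness_of_small_eps {ε : ℝ} (hε : 0 < ε)
    (hsmall : ε * Real.log (Nat.card (ConjClasses G)) ≤ 2 / 3 * Real.log 2)
    (J : Submodule ℂ (G → ℂ)) (hJ : (∀ f ∈ J, ∀ a b : G, (fun g : G => f (a * g * b)) ∈ J)) (X Y Z : Finset G)
    (hsep : (∀ x₀ ∈ X, ∀ z₀ ∈ Z, ∃ f ∈ J, ∀ x ∈ X, ∀ y ∈ Y, ∀ y' ∈ Y, ∀ z ∈ Z,
      (x = x₀ ∧ y = y' ∧ z = z₀ → f (x⁻¹ * y * y'⁻¹ * z) = 1) ∧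
      (¬ (x = x₀ ∧ y = y' ∧ z = z₀) → f (x⁻¹ * y * y'⁻¹ * z) = 0))) :
    ¬ (∑ᶠ χ ∈ irrChars G ∩ (J : Set (G → ℂ)), (χ 1).re ^ ((2 + ε) : ℝ)) < ((X.card * Y.card * Z.card : ℕ) : ℝ) ^ ((2 + ε) / 3) := by
  intro hlt
  have h := conjClasses_law hε J hJ X Y Z hsep hlt
  have hkpos : (0 : ℝ) < (Nat.card (ConjClasses G) : ℝ) := by
    have : 0 < Nat.card (ConjClasses G) := Nat.card_pos
    exact_mod_cast this
  have h1 : (Nat.card (ConjClasses G) : ℝ) ^ ε ≤ (2 : ℝ) ^ ((2 : ℝ) / 3) := by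
    rw [Real.rpow_def_of_pos hkpos, Real.rpow_def_of_pos two_pos]
    exact Real.exp_le_exp.2 (by nlinarith)
  have h2 : (2 : ℝ) ^ ((2 : ℝ) / 3) < (2 : ℝ) ^ ((2 + ε) / 3) :=
    Real.rpow_lt_rpow_of_exponent_lt one_lt_two (by linarith)
  linarith

/-- **No fixed host**: for every finite group there is `ε₀ > 0` below which it carries no
witness — every witness family for the crux lets `|G| → ∞` (indeed `log k(G) ≳ 1/ε`).
[folklore] -/
theorem no_fixed_host (G : Type) [Group G] [Fintype G] :
    ∃ ε₀ : ℝ, 0 < ε₀ ∧ ∀ ε : ℝ, 0 < ε → ε ≤ ε₀ →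
      ∀ (J : Submodule ℂ (G → ℂ)), (∀ f ∈ J, ∀ a b : G, (fun g : G => f (a * g * b)) ∈ J) → ∀ (X Y Z : Finset G),
      (∀ x₀ ∈ X, ∀ z₀ ∈ Z, ∃ f ∈ J, ∀ x ∈ X, ∀ y ∈ Y, ∀ y' ∈ Y, ∀ z ∈ Z,
      (x = x₀ ∧ y = y' ∧ z = z₀ → f (x⁻¹ * y * y'⁻¹ * z) = 1) ∧
      (¬ (x = x₀ ∧ y = y' ∧ z = z₀) → f (x⁻¹ * y * y'⁻¹ * z) = 0)) →
      ¬ (∑ᶠ χ ∈ irrChars G ∩ (J : Set (G → ℂ)), (χ 1).re ^ ((2 + ε) : ℝ)) < ((X.card * Y.card * Z.card : ℕ) : ℝ) ^ ((2 + ε) / 3) := by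
  by_cases hk : Real.log (Nat.card (ConjClasses G)) ≤ 0
  · refine ⟨1, one_pos, fun ε hε _ J hJ X Y Z hsep => no_witness_of_small_eps hε ?_ J hJ X Y Z hsep⟩
    have : 0 < Real.log 2 := Real.log_pos one_lt_two
    nlinarith
  · push Not at hk
    refine ⟨2 / 3 * Real.log 2 / Real.log (Nat.card (ConjClasses G)), by
      have : 0 < Real.log 2 := Real.log_pos one_lt_two
      positivity, fun ε hε hle J hJ X Y Z hsep => no_witness_of_small_eps hε ?_ J hJ X Y Z hsep⟩
    rwa [le_div_iff₀ hk] at hle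


end Law

end Summit.MatrixMultiplication.MatrixMultiplication.Theorems.GradedDesignFamily.Negative

end
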